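import Summits.Parity.GeneralizedHardyLittlewood.Theorems.BeyondDiagonalBeatsQuarter.OffDiagDualLedgerRow
import HarnessLib

/-!
# Route `PrimeLevelFamEdge`, crux K_B (stmt-Parity-20343), line `diagonal_kernel_split` rev 4, plan Ω,
# worker key L3 (part 6d, total) `OffDiagDualLedgerTotal`: the TRIVIAL LEDGER of the finite dual core —
# `Σ_{r≤R} Σ_{l,m≤M} |c_lc_m| Σ_{d₁∣l,d₂∣m} Σ_{i near} Σ_{|h_j|≤A_j} ‖Φ̂_i(h/(qr))‖·N
#    ≤ (log₂⌊4q̂²y₀⌋+1)² · ledgerRow · (1 + log R) · C³ M^{1+2δ} M^{1+δ}`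

Assembly of the uniform row (`OffDiagDualLedgerRow.sum_dualBox_norm_le_row`: per near box
`≤ ledgerRow·gcd(l/d₁,r)·√(lm)·r⁻¹`) with the counting tools (`card_nearBoxes_le`, `sum_gcd_div_le`) and the
mollifier size `|c_m| ≤ m^{−1/2}` (`P = X²`, `M > 1`), `τ(n) ≤ Cn^δ`:
* `sum_range_succ_gcd_div_le` — `Σ_{r<R} gcd(a,r+1)/(r+1) ≤ τ(a)(1 + log R)`;
* **`dualLedgerTotal_le`** — for `q` prime, `1 < M < q`, `R ≥ 1`, `y₀ > 0`, `Λ ≥ 0`, `δ ≥ 0`, and ANY truncation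
  `A : ℕ → ℕ → ℕ → ℕ → ℕ → ℕ×ℕ → ℕ×ℕ` with `A₁A₂ ≤ Λ(q(r+1))²(1+Z)²Q²/(K₁K₂)` at every `(r,l,m,d₁,d₂,i)`:
  the total above (layers indexed by `r+1`, `r < R`, so that the modulus `q(r+1)` carries its `NeZero` instance,
  as in `OffDiag.offDiagNearHead_eq_dual`) is
  `≤ (Nat.log 2 ⌊4q̂²y₀⌋₊+1)²·ledgerRow(q,M,R,y₀,Λ,Q,δ,C)·(1+log R)·(C²M^{2δ+1})·(CM^{δ+1})`.
Reading (not typed here): at `M = q̂^{Δ′}`, `R = q⁷`, `y₀ = (log q)⁴`, `Q = q^{ε}`: `ledgerRow ≍ ΛQ²q^{16δ}·q̂^{η/2}L`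
and `M² = q̂^{2Δ′}`, so with the prefactor `4πq̂/q` the finite dual core is `≲ q̂^{1+(5/2)η+O(ε+δ)}L^{O(1)} =
q^{(5/4)η+o(1)}·mainScaleReal` — `κ₀ = 5/4` (OMEGA-BLUEPRINT L3; window `OmegaWindowV4`).
Absolute values only; nothing about the heart. Helper (`--supports stmt-Parity-20343`); standard axioms.
«The programme SEARCHES and TYPES; no claim about Landau–Siegel zeros, Theorems 1–2 of arXiv:2211.02515 or
a repaired Margin232 until a kernel theorem says so.»
-/

noncomputable section

open Finset Polynomial
open scoped Real

namespace Summit.Parity.GeneralizedHardyLittlewood.Theorems.BeyondDiagonalBeatsQuarter.OffDiag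

open Literature.NumberTheory.LFunctions Literature.NumberTheory.LFunctions.KMV2000
open Literature.Analysis.FunctionSpaces (besselJ)
open Literature.NumberTheory.Sieve.FriedlanderIwaniecPrimes (fourier2)
open Summit.Parity.GeneralizedHardyLittlewood.Theorems.PrimeLevelFamEdgeIdeaDeltas.PeterssonLayers
  (norm_mollifierCoeff_le sum_Icc_rpow_le)

/-! ### §1. Two more sums -/

/-- `Σ_{r<R} gcd(a, r+1)/(r+1) ≤ τ(a)(1 + log R)` (`a ≥ 1`; `sum_gcd_div_le` re-indexed). [folklore] -/
theorem sum_range_succ_gcd_div_le {a : ℕ} (ha : 1 ≤ a) (R : ℕ) :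
    ∑ r ∈ Finset.range R, ((Nat.gcd a (r + 1) : ℕ) : ℝ) / ((r + 1 : ℕ) : ℝ) ≤
      (a.divisors.card : ℝ) * (1 + Real.log R) := by
  have h := sum_gcd_div_le ha R
  have e : ∑ r' ∈ Finset.Icc 1 R, ((Nat.gcd a r' : ℕ) : ℝ) / r' =
      ∑ r ∈ Finset.range R, ((Nat.gcd a (r + 1) : ℕ) : ℝ) / ((r + 1 : ℕ) : ℝ) := by
    rw [← Finset.Ico_add_one_right_eq_Icc, Finset.sum_Ico_eq_sum_range]
    refine Finset.sum_congr (by simp) fun r _ ↦ ?_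
    rw [add_comm 1 r]
  rwa [e] at h

/-- `τ(l/d) ≤ τ(l)` for `d ∣ l`, `l ≥ 1`. [folklore] -/
theorem card_divisors_div_le {l d : ℕ} (hl : 1 ≤ l) (hd : d ∣ l) : (l / d).divisors.card ≤ l.divisors.card :=
  Finset.card_le_card (Nat.divisors_subset_of_dvd (by omega) (Nat.div_dvd_of_dvd hd))

/-- The mollifier side: `Σ_{l ≤ M} |c_l|·√l·τ(l)^k ≤ C^k·M^{kδ+1}` for `P = X²`, `M > 1`, `τ(n) ≤ Cn^δ`, `k ∈ ℕ`
(`|c_l| ≤ l^{−1/2}`). [cite: KowalskiMichelVanderKam2000, (9) p. 7 — derivation] -/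
theorem sum_abs_coeff_sqrt_tau_pow_le {M : ℝ} (hM : 1 < M) {δ C : ℝ} (hδ : 0 ≤ δ)
    (hC : ∀ n : ℕ, ((n.divisors.card : ℕ) : ℝ) ≤ C * (n : ℝ) ^ δ) (k : ℕ) :
    ∑ l ∈ Finset.Icc 1 ⌊M⌋₊, |mollifierCoeff (X ^ 2) M l| * Real.sqrt l * (l.divisors.card : ℝ) ^ k ≤
      C ^ k * M ^ (k * δ + 1) := by
  have hC0 : 0 ≤ C := by
    have h := hC 1
    simp at h
    linarith
  have hpt : ∀ l ∈ Finset.Icc 1 ⌊M⌋₊,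
      |mollifierCoeff (X ^ 2) M l| * Real.sqrt l * (l.divisors.card : ℝ) ^ k ≤ C ^ k * (l : ℝ) ^ (k * δ) := by
    intro l hl
    have hl0 : (0 : ℝ) < l := by exact_mod_cast (Finset.mem_Icc.1 hl).1
    have hX : ∀ t ∈ Set.Icc (0 : ℝ) 1, |(X ^ 2 : ℝ[X]).eval t| ≤ 1 := by
      intro t ht
      rw [eval_pow, eval_X, abs_pow, abs_of_nonneg ht.1]
      exact pow_le_one₀ ht.1 ht.2
    have hc := norm_mollifierCoeff_le hX hM hl
    rw [Complex.norm_real, Real.norm_eq_abs, one_mul] at hc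
    have h1 : |mollifierCoeff (X ^ 2) M l| * Real.sqrt l ≤ 1 := by
      calc |mollifierCoeff (X ^ 2) M l| * Real.sqrt l ≤ (l : ℝ) ^ (-(1 / 2 : ℝ)) * Real.sqrt l :=
            mul_le_mul_of_nonneg_right hc (Real.sqrt_nonneg _)
        _ = 1 := by
            rw [Real.sqrt_eq_rpow, ← Real.rpow_add hl0]; norm_num
    have h2 : (l.divisors.card : ℝ) ^ k ≤ (C * (l : ℝ) ^ δ) ^ k :=
      pow_le_pow_left₀ (Nat.cast_nonneg _) (hC l) k
    calc |mollifierCoeff (X ^ 2) M l| * Real.sqrt l * (l.divisors.card : ℝ) ^ k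
        ≤ 1 * (C * (l : ℝ) ^ δ) ^ k := mul_le_mul h1 h2 (by positivity) zero_le_one
      _ = C ^ k * (l : ℝ) ^ (k * δ) := by
          rw [one_mul, mul_pow, ← Real.rpow_natCast ((l : ℝ) ^ δ) k, ← Real.rpow_mul hl0.le, mul_comm δ]
  have hS := sum_Icc_rpow_le hM.le (by positivity : (0 : ℝ) ≤ k * δ)
  calc _ ≤ ∑ l ∈ Finset.Icc 1 ⌊M⌋₊, C ^ k * (l : ℝ) ^ (k * δ) := Finset.sum_le_sum hpt
    _ = C ^ k * ∑ l ∈ Finset.Icc 1 ⌊M⌋₊, (l : ℝ) ^ ((k : ℝ) * δ) := by rw [Finset.mul_sum]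
    _ ≤ C ^ k * M ^ (k * δ + 1) := mul_le_mul_of_nonneg_left hS (by positivity)

/-! ### §2. The total -/

/-- **The trivial ledger of the finite dual core.** Let `q` be prime, `1 < M < q`, `R ∈ ℕ`, `y₀ > 0`, `Λ ≥ 0`,
`δ ≥ 0`, `τ(n) ≤ Cn^δ`, and `A` any truncation with `A₁A₂ ≤ Λ(q(r+1))²(1+Z)²Q²/(K₁K₂)` at every index. Then
`Σ_{r<R} Σ_{l,m≤M} |c_lc_m| Σ_{d₁∣l,d₂∣m} Σ_{i ∈ nearBoxes} Σ_{|h_j| ≤ A_j} ‖Φ̂_i(h/(q(r+1)))‖·N_{q(r+1)}(l/d₁,m/d₂;h)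
  ≤ (Nat.log 2 ⌊4q̂²y₀⌋₊+1)² · ledgerRow q M R y₀ Λ Q δ C · (1 + log R) · (C²M^{2δ+1}) · (CM^{δ+1})`.
[cite: KowalskiMichelVanderKam2000, (21)–(23) p. 12 and Lemma 3.3 p. 9 — derivation] -/
theorem dualLedgerTotal_le {q : ℕ} [NeZero q] (hq : q.Prime) {M : ℝ} (hM : 1 < M) (hMq : M < q) (R : ℕ)
    {y₀ : ℝ} (hy₀ : 0 < y₀) {Λ Q δ C : ℝ} (hΛ : 0 ≤ Λ) (hδ : 0 ≤ δ)
    (hC : ∀ n : ℕ, ((n.divisors.card : ℕ) : ℝ) ≤ C * (n : ℝ) ^ δ)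
    (A : ℕ → ℕ → ℕ → ℕ → ℕ → ℕ × ℕ → ℕ × ℕ)
    (hA : ∀ r l m d₁ d₂ : ℕ, ∀ i : ℕ × ℕ,
      (((A r l m d₁ d₂ i).1 : ℝ)) * (A r l m d₁ d₂ i).2 ≤ Λ * (((q : ℝ) * ((r + 1 : ℕ) : ℝ)) ^ 2 *
        (1 + 4 * π * Real.sqrt (((l / d₁ : ℕ) : ℝ) * ((m / d₂ : ℕ) : ℝ) * ((2 : ℝ) ^ i.1 * 2 ^ i.2)) /
          ((q : ℝ) * ((r + 1 : ℕ) : ℝ))) ^ 2 * Q ^ 2 / ((2 : ℝ) ^ i.1 * 2 ^ i.2))) :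
    ∑ r ∈ Finset.range R, ∑ l ∈ Finset.Icc 1 ⌊M⌋₊, ∑ m ∈ Finset.Icc 1 ⌊M⌋₊,
      |mollifierCoeff (X ^ 2) M l * mollifierCoeff (X ^ 2) M m| *
        ∑ d₁ ∈ l.divisors, ∑ d₂ ∈ m.divisors, ∑ i ∈ PeterssonSplit.nearBoxes q d₁ d₂ y₀,
          ∑ h ∈ (Finset.Icc (-((A r l m d₁ d₂ i).1 : ℤ)) (A r l m d₁ d₂ i).1) ×ˢ
              (Finset.Icc (-((A r l m d₁ d₂ i).2 : ℤ)) (A r l m d₁ d₂ i).2),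
            ‖fourier2 (boxWeight q d₁ d₂ (l / d₁) (m / d₂) (r + 1) i) (h.1 / (q * (r + 1) : ℕ))
                (h.2 / (q * (r + 1) : ℕ))‖ *
              (dualCount (q * (r + 1)) ((l / d₁ : ℕ) : ZMod (q * (r + 1))) ((m / d₂ : ℕ) : ZMod (q * (r + 1)))
                (h.1 : ZMod (q * (r + 1))) (h.2 : ZMod (q * (r + 1))) : ℝ) ≤
      ((Nat.log 2 ⌊4 * qhat q ^ 2 * y₀⌋₊ + 1) ^ 2 : ℕ) * ledgerRow q M R y₀ Λ Q δ C * (1 + Real.log R) *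
        ((C ^ 2 * M ^ (2 * δ + 1)) * (C * M ^ (δ + 1))) := by
  have hC0 : 0 ≤ C := by
    have h := hC 1
    simp at h
    linarith
  set Nb : ℕ := (Nat.log 2 ⌊4 * qhat q ^ 2 * y₀⌋₊ + 1) ^ 2 with hNb
  set ROW : ℝ := ledgerRow q M R y₀ Λ Q δ C with hROW
  have hROW0 : 0 ≤ ROW := ledgerRow_nonneg q hC0 hΛ hy₀.le
  have hlogR : 0 ≤ 1 + Real.log R := by
    have : 0 ≤ Real.log R := Real.log_natCast_nonneg R
    linarith
  -- Step 1–3: for fixed `r, l, m`, the inner sums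
  have hinner : ∀ r ∈ Finset.range R, ∀ l ∈ Finset.Icc 1 ⌊M⌋₊, ∀ m ∈ Finset.Icc 1 ⌊M⌋₊,
      ∑ d₁ ∈ l.divisors, ∑ d₂ ∈ m.divisors, ∑ i ∈ PeterssonSplit.nearBoxes q d₁ d₂ y₀,
        ∑ h ∈ (Finset.Icc (-((A r l m d₁ d₂ i).1 : ℤ)) (A r l m d₁ d₂ i).1) ×ˢ
            (Finset.Icc (-((A r l m d₁ d₂ i).2 : ℤ)) (A r l m d₁ d₂ i).2),
          ‖fourier2 (boxWeight q d₁ d₂ (l / d₁) (m / d₂) (r + 1) i) (h.1 / (q * (r + 1) : ℕ))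
              (h.2 / (q * (r + 1) : ℕ))‖ *
            (dualCount (q * (r + 1)) ((l / d₁ : ℕ) : ZMod (q * (r + 1))) ((m / d₂ : ℕ) : ZMod (q * (r + 1)))
              (h.1 : ZMod (q * (r + 1))) (h.2 : ZMod (q * (r + 1))) : ℝ) ≤
        (Nb : ℝ) * ROW * Real.sqrt ((l : ℝ) * m) * (m.divisors.card : ℝ) *
          ∑ d₁ ∈ l.divisors, ((Nat.gcd (l / d₁) (r + 1) : ℕ) : ℝ) / ((r + 1 : ℕ) : ℝ) := by
    intro r hr l hl m hm
    have hrR : (((r + 1 : ℕ) : ℕ) : ℝ) ≤ R := by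
      have := Finset.mem_range.1 hr; exact_mod_cast this
    -- per box
    have hbox : ∀ d₁ ∈ l.divisors, ∀ d₂ ∈ m.divisors, ∀ i ∈ PeterssonSplit.nearBoxes q d₁ d₂ y₀,
        ∑ h ∈ (Finset.Icc (-((A r l m d₁ d₂ i).1 : ℤ)) (A r l m d₁ d₂ i).1) ×ˢ
            (Finset.Icc (-((A r l m d₁ d₂ i).2 : ℤ)) (A r l m d₁ d₂ i).2),
          ‖fourier2 (boxWeight q d₁ d₂ (l / d₁) (m / d₂) (r + 1) i) (h.1 / (q * (r + 1) : ℕ))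
              (h.2 / (q * (r + 1) : ℕ))‖ *
            (dualCount (q * (r + 1)) ((l / d₁ : ℕ) : ZMod (q * (r + 1))) ((m / d₂ : ℕ) : ZMod (q * (r + 1)))
              (h.1 : ZMod (q * (r + 1))) (h.2 : ZMod (q * (r + 1))) : ℝ) ≤
          ROW * ((Nat.gcd (l / d₁) (r + 1) : ℕ) : ℝ) * Real.sqrt ((l : ℝ) * m) * (((r + 1 : ℕ) : ℝ))⁻¹ :=
      fun d₁ hd₁ d₂ hd₂ i hi ↦ sum_dualBox_norm_le_row hq hMq hl hm hd₁ hd₂ (Nat.succ_le_succ (Nat.zero_le r))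
        hrR hy₀ hi hΛ hδ hC (hA r l m d₁ d₂ i)
    -- sum over `i`: card × bound
    have hi_sum : ∀ d₁ ∈ l.divisors, ∀ d₂ ∈ m.divisors,
        ∑ i ∈ PeterssonSplit.nearBoxes q d₁ d₂ y₀,
          ∑ h ∈ (Finset.Icc (-((A r l m d₁ d₂ i).1 : ℤ)) (A r l m d₁ d₂ i).1) ×ˢ
              (Finset.Icc (-((A r l m d₁ d₂ i).2 : ℤ)) (A r l m d₁ d₂ i).2),
            ‖fourier2 (boxWeight q d₁ d₂ (l / d₁) (m / d₂) (r + 1) i) (h.1 / (q * (r + 1) : ℕ))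
                (h.2 / (q * (r + 1) : ℕ))‖ *
              (dualCount (q * (r + 1)) ((l / d₁ : ℕ) : ZMod (q * (r + 1))) ((m / d₂ : ℕ) : ZMod (q * (r + 1)))
                (h.1 : ZMod (q * (r + 1))) (h.2 : ZMod (q * (r + 1))) : ℝ) ≤
          (Nb : ℝ) * (ROW * ((Nat.gcd (l / d₁) (r + 1) : ℕ) : ℝ) * Real.sqrt ((l : ℝ) * m) *
            (((r + 1 : ℕ) : ℝ))⁻¹) := by
      intro d₁ hd₁ d₂ hd₂
      have hb0 : 0 ≤ ROW * ((Nat.gcd (l / d₁) (r + 1) : ℕ) : ℝ) * Real.sqrt ((l : ℝ) * m) *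
          (((r + 1 : ℕ) : ℝ))⁻¹ := by positivity
      have hcard : ((PeterssonSplit.nearBoxes q d₁ d₂ y₀).card : ℝ) ≤ Nb := by
        exact_mod_cast card_nearBoxes_le
          (Nat.mul_le_mul (Nat.pos_of_mem_divisors hd₁) (Nat.pos_of_mem_divisors hd₂)) y₀
      calc _ ≤ ∑ i ∈ PeterssonSplit.nearBoxes q d₁ d₂ y₀, (ROW * ((Nat.gcd (l / d₁) (r + 1) : ℕ) : ℝ) *
            Real.sqrt ((l : ℝ) * m) * (((r + 1 : ℕ) : ℝ))⁻¹) :=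
            Finset.sum_le_sum fun i hi ↦ hbox d₁ hd₁ d₂ hd₂ i hi
        _ = ((PeterssonSplit.nearBoxes q d₁ d₂ y₀).card : ℝ) * (ROW * ((Nat.gcd (l / d₁) (r + 1) : ℕ) : ℝ) *
            Real.sqrt ((l : ℝ) * m) * (((r + 1 : ℕ) : ℝ))⁻¹) := by rw [Finset.sum_const, nsmul_eq_mul]
        _ ≤ _ := mul_le_mul_of_nonneg_right hcard hb0
    calc _ ≤ ∑ d₁ ∈ l.divisors, ∑ d₂ ∈ m.divisors, (Nb : ℝ) * (ROW * ((Nat.gcd (l / d₁) (r + 1) : ℕ) : ℝ) *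
          Real.sqrt ((l : ℝ) * m) * (((r + 1 : ℕ) : ℝ))⁻¹) :=
          Finset.sum_le_sum fun d₁ hd₁ ↦ Finset.sum_le_sum fun d₂ hd₂ ↦ hi_sum d₁ hd₁ d₂ hd₂
      _ = _ := by
          simp only [Finset.sum_const, nsmul_eq_mul, Finset.mul_sum]
          refine Finset.sum_congr rfl fun d₁ _ ↦ ?_
          rw [div_eq_mul_inv]; ring
  -- Step 4: the `r`-sum of the gcd factor, per `l`
  have hr_sum : ∀ l ∈ Finset.Icc 1 ⌊M⌋₊,
      ∑ r ∈ Finset.range R, ∑ d₁ ∈ l.divisors, ((Nat.gcd (l / d₁) (r + 1) : ℕ) : ℝ) / ((r + 1 : ℕ) : ℝ) ≤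
        (l.divisors.card : ℝ) ^ 2 * (1 + Real.log R) := by
    intro l hl
    have hl1 := (Finset.mem_Icc.1 hl).1
    rw [Finset.sum_comm]
    calc ∑ d₁ ∈ l.divisors, ∑ r ∈ Finset.range R, ((Nat.gcd (l / d₁) (r + 1) : ℕ) : ℝ) / ((r + 1 : ℕ) : ℝ)
        ≤ ∑ d₁ ∈ l.divisors, ((l / d₁).divisors.card : ℝ) * (1 + Real.log R) :=
          Finset.sum_le_sum fun d₁ hd₁ ↦ sum_range_succ_gcd_div_le
            (OffDiagDual.one_le_div_of_dvd (Nat.dvd_of_mem_divisors hd₁) hl1) R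
      _ ≤ ∑ d₁ ∈ l.divisors, (l.divisors.card : ℝ) * (1 + Real.log R) :=
          Finset.sum_le_sum fun d₁ hd₁ ↦ mul_le_mul_of_nonneg_right
            (by exact_mod_cast card_divisors_div_le hl1 (Nat.dvd_of_mem_divisors hd₁)) hlogR
      _ = (l.divisors.card : ℝ) ^ 2 * (1 + Real.log R) := by rw [Finset.sum_const, nsmul_eq_mul]; ring
  -- Step 5: assemble; swap `r` with `(l,m)`
  have hsqrt : ∀ l m : ℕ, Real.sqrt ((l : ℝ) * m) = Real.sqrt l * Real.sqrt m :=
    fun l m ↦ Real.sqrt_mul (Nat.cast_nonneg _) _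
  calc _ ≤ ∑ r ∈ Finset.range R, ∑ l ∈ Finset.Icc 1 ⌊M⌋₊, ∑ m ∈ Finset.Icc 1 ⌊M⌋₊,
          |mollifierCoeff (X ^ 2) M l * mollifierCoeff (X ^ 2) M m| *
            ((Nb : ℝ) * ROW * Real.sqrt ((l : ℝ) * m) * (m.divisors.card : ℝ) *
              ∑ d₁ ∈ l.divisors, ((Nat.gcd (l / d₁) (r + 1) : ℕ) : ℝ) / ((r + 1 : ℕ) : ℝ)) :=
        Finset.sum_le_sum fun r hr ↦ Finset.sum_le_sum fun l hl ↦ Finset.sum_le_sum fun m hm ↦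
          mul_le_mul_of_nonneg_left (hinner r hr l hl m hm) (abs_nonneg _)
    _ = (Nb : ℝ) * ROW * ∑ l ∈ Finset.Icc 1 ⌊M⌋₊, ∑ m ∈ Finset.Icc 1 ⌊M⌋₊,
          (|mollifierCoeff (X ^ 2) M l| * Real.sqrt l) * (|mollifierCoeff (X ^ 2) M m| * Real.sqrt m *
            (m.divisors.card : ℝ)) *
          ∑ r ∈ Finset.range R, ∑ d₁ ∈ l.divisors, ((Nat.gcd (l / d₁) (r + 1) : ℕ) : ℝ) / ((r + 1 : ℕ) : ℝ) := by
        rw [Finset.sum_comm]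
        simp only [Finset.mul_sum]
        refine Finset.sum_congr rfl fun l _ ↦ ?_
        rw [Finset.sum_comm]
        refine Finset.sum_congr rfl fun m _ ↦ ?_
        refine Finset.sum_congr rfl fun r _ ↦ ?_
        rw [abs_mul, hsqrt]
        exact Finset.sum_congr rfl fun _ _ ↦ by ring
    _ ≤ (Nb : ℝ) * ROW * ∑ l ∈ Finset.Icc 1 ⌊M⌋₊, ∑ m ∈ Finset.Icc 1 ⌊M⌋₊,
          (|mollifierCoeff (X ^ 2) M l| * Real.sqrt l) * (|mollifierCoeff (X ^ 2) M m| * Real.sqrt m *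
            (m.divisors.card : ℝ)) * ((l.divisors.card : ℝ) ^ 2 * (1 + Real.log R)) := by
        refine mul_le_mul_of_nonneg_left (Finset.sum_le_sum fun l hl ↦ Finset.sum_le_sum fun m _ ↦
          mul_le_mul_of_nonneg_left (hr_sum l hl) (by positivity)) (by positivity)
    _ = (Nb : ℝ) * ROW * (1 + Real.log R) *
          ((∑ l ∈ Finset.Icc 1 ⌊M⌋₊, |mollifierCoeff (X ^ 2) M l| * Real.sqrt l * (l.divisors.card : ℝ) ^ 2) *
            (∑ m ∈ Finset.Icc 1 ⌊M⌋₊, |mollifierCoeff (X ^ 2) M m| * Real.sqrt m * (m.divisors.card : ℝ) ^ 1)) := by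
        rw [Finset.sum_mul_sum]
        simp only [Finset.mul_sum, pow_one]
        refine Finset.sum_congr rfl fun l _ ↦ Finset.sum_congr rfl fun m _ ↦ ?_
        ring
    _ ≤ (Nb : ℝ) * ROW * (1 + Real.log R) * ((C ^ 2 * M ^ (2 * δ + 1)) * (C ^ 1 * M ^ (1 * δ + 1))) := by
        refine mul_le_mul_of_nonneg_left ?_ (by positivity)
        have h2 := sum_abs_coeff_sqrt_tau_pow_le hM hδ hC 2
        have h1 := sum_abs_coeff_sqrt_tau_pow_le hM hδ hC 1
        push_cast at h2 h1
        exact mul_le_mul h2 h1 (Finset.sum_nonneg fun _ _ ↦ by positivity) (by positivity)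
    _ = _ := by rw [hROW, hNb]; ring_nf

end Summit.Parity.GeneralizedHardyLittlewood.Theorems.BeyondDiagonalBeatsQuarter.OffDiag
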